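import Literature.AlgebraicGeometry.ModuliOfAbelianVarieties.SiegelFamilyHumbertGeneralMember
import Literature.AlgebraicGeometry.ModuliOfAbelianVarieties.SiegelModuliHumbertSurfaces
import Literature.AlgebraicGeometry.ModuliOfAbelianVarieties.SiegelFamilyHumbertModularEquivariance
import Mathlib.Algebra.Pointwise.Stabilizer
import HarnessLib

/-!
# The Humbert modular group `Γ(q) = Stab_{Sp₄(ℤ)}(H_q)` and the generic injectivity of `Γ(q)\H_q → 𝒜₂`
# (Runge 1999 §3 p. 287 "`Γ(L) = {σ ∈ Γ_g ; σL = Lσ}` … the induced map `Γ(L)\H(L) → Γ_g\ℍ_g` is injective for points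
# with `End⁰(A_τ) = L`. Therefore it is generically injective. The group `Γ(L)` is the largest subgroup of `Γ_g`
# acting on `H(L)`"; §4 p. 291 "By taking the quotient `Γ(F)\H(F)`, we get the standard model for Humbert surfaces.
# The Humbert modular group `Γ(F) = Γ(Δ)` …")

Layer `Literature/AlgebraicGeometry/ModuliOfAbelianVarieties`, namespace
`Literature.AlgebraicGeometry.ModuliOfAbelianVarieties.SiegelModuli`; lane `lit-hodgefound` (Track 2 foundations
library, Layer A4), seat `lit-hodgefound-skel-4`, row **A4-71**, FILE 1 (one definition with body, one `MulAction`
instance, two quotient `abbrev`s, two plumbing `def`s; theorems otherwise; NO named fact, NO sorry, net debt 0).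
Everything is consumed BY NAME from rows A4-59″ (`SiegelFamilyHumbertSymplectic`: the transport
`mem_humbertLocus_humbertVectorConj_iff`, `H_{q^M} = M · H_q`, `humbertInvariant_humbertVectorConj`,
`humbertVectorConj_ne_zero`), A4-65 F1/F4 (`SiegelFamilyHumbertLemma`: `IsPrimitiveRel`, `HumbertEquiv`, `spUnit`;
`SiegelFamilyHumbertGeneralMember`: `IsPrimitiveRel.humbertLocus_eq_iff`, `IsPrimitiveRel.humbertLocus_subset_closure`),
A4-70 F2/F3 (`SiegelModuliHumbertSurfaces`: `siegelThreefold = Sp₄(ℤ)\𝔥₂`, `siegelThreefold.mk_eq_mk_iff`,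
`humbertSurface_eq_image_humbertLocus`; `SiegelFamilyHumbertModularEquivariance`: `modularEmbeddingLift`,
`modularEmbeddingLift_smul_mem_humbertLocus`) and A4-16/A4-56′ (`gDHom`, `levelGD`, `mem_levelGD_one_iff`).

## Source, verbatim

B. Runge, *Endomorphism rings of abelian surfaces and projective models of their moduli spaces*, Tohoku Math. J.
51 (1999), §3 p. 287 (held `paper:doi-10-2748-tmj-1178224764` p0005): "This leads to the following definitions for
any admissible algebra `L ⊂ M_{2g}(ℚ)`: `H(L) = {τ ∈ ℍ_g | lM_τ = M_τl for all l ∈ L}`, `Γ(L) = {σ ∈ Γ_g ; σL = Lσ}`.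
… It is obvious that `Γ(L)` is acting on `H(L)`, and the induced map `Γ(L)\H(L) → Γ_g\ℍ_g` is injective for points
with `End⁰(A_τ) = L`. Therefore it is generically injective. The group `Γ(L)` is the largest subgroup of `Γ_g`
acting on `H(L)`."  §4 p. 291 (p0009): "By the last theorem any period `τ = π[R]` with `O ⊂ End(Λ_τ)` lies in a
manifold `H(F)` as constructed above. By taking the quotient `Γ(F)\H(F)`, we get the standard model for Humbert
surfaces. The Humbert modular group `Γ(F) = Γ(Δ)` is described in the following lemma. LEMMA 4. … The Humbert
modular group `Γ(F) = Γ(Δ)` is generated by `σ_Gal` and `ψ_O(Sl(2, O))`."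

For `g = 2` and the real quadratic algebra `L = ℚ(f_q)` of an integer singular relation `q` (B–W Lemma 4.1 / (8):
`H(L)` is the Humbert locus `H_q ⊂ 𝔥₂` of row A4-59), `Γ(L)` is — by Runge's "largest subgroup of `Γ_g` acting on
`H(L)`" — the SET STABILISER of `H_q` in `Γ₂ = Sp₄(ℤ)`; this file takes that sentence as the definition
(`humbertModularGroup q := G_1 ⊓ Stab(H_q)`, `G_1 = gDHom(Sp₄(ℤ)) ⊂ Sp₄(ℝ)` of row A4-16) and proves the printed
sentences around it.  "Points with `End⁰(A_τ) = L`" are rendered, as in row A4-65 F4 (B–W Prop. 4.9 (2) "general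
member"), by: the lattice of integer singular relations of `Z` is exactly `ℤq`
(`∀ q′, rel_{q′}(Z) = 0 → q′ ∈ ℤq`; equivalently `ρ(X_Z) = 2`, `NS_ℚ ≅ End^s_ℚ = ℚ(√Δ)`).

## Contents (proved; no named fact)

* §1 **`humbertModularGroup q = Γ(q)`**; `mem_humbertModularGroup_iff`; **`le_humbertModularGroup_iff`** ("the largest
  subgroup of `Γ_g` acting on `H(L)`"); `Γ(mq) = Γ(q)` (`m ≠ 0`), `Γ(0) = G_1`.
* §2 THE ACTION ON RELATIONS: `mem_humbertLocus_humbertVectorConj_iff_gDHom_smul` (`W ∈ H_{q^N} ⟺ gDHom(N)·W ∈ H_q`),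
  **`gDHom_mem_humbertModularGroup_iff`** (`gDHom(N) ∈ Γ(q) ⟺ H_{q^N} = H_q`) and, for `q` primitive with `Δ(q) > 0`,
  **`IsPrimitiveRel.gDHom_mem_humbertModularGroup_iff`** (`⟺ q^N = ±q` — Runge's "`σL = Lσ`": `σ` fixes the line of
  the relation), **`humbertModularGroup_humbertVectorConj`** (`Γ(q^N) = gDHom(N)⁻¹ Γ(q) gDHom(N)`: equivalent relations
  have conjugate groups) and `IsPrimitiveRel.exists_humbertModularGroup_eq_map_conj` (all primitive `q` of one
  invariant `Δ`: "`Γ(F) = Γ(Δ)`" is well defined up to conjugacy in `G_1`, by Humbert's lemma, row A4-65).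
* §3 GENERIC INJECTIVITY: **`mem_humbertModularGroup_of_smul_mem`** (if the relation lattice of `Z` is `ℤq` and
  `γ ∈ G_1` moves `Z` into `H_q`, then `γ ∈ Γ(q)`), `exists_mem_humbertModularGroup_smul_eq`.
* §4 THE STANDARD MODEL `Γ(q)\H_q → 𝒜₂`: the action `humbertModularGroup.instMulAction`, the orbit space
  **`humbertModularQuotient q = Γ(q)\H_q`**, **`humbertModularQuotient.toSiegel : Γ(q)\H_q → 𝒜₂`** (continuous,
  `range = 𝔥₂→𝒜₂ '' H_q`, `= humbertSurface Δ(q)` for primitive `q`: `range_toSiegel_eq_humbertSurface`),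
  **`humbertModularQuotient.mk_eq_mk_of_forall`** / **`injOn_toSiegel`** ("injective for points with `End⁰(A_τ) = L`")
  and **`IsPrimitiveRel.dense_image_mk_setOf_forall`** ("therefore it is generically injective": those points are dense
  in `Γ(q)\H_q`, from row A4-65 F4).
* §5 RUNGE'S MODEL: `modularEmbeddingLift_mem_humbertModularGroup` (an integral lift `(ᵗR 0; 0 R⁻¹)σ(g)(ᵗR 0; 0 R⁻¹)⁻¹`
  of `g ∈ SL₂(ℝ)²` lies in `Γ((k,l,−1,0,0))` — the containment `ψ_O(Sl(2,O)) ⊆ Γ(Δ)` of Lemma 4 for every integral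
  lift) and `exists_mem_humbertModularGroup_smul_modularEmbedding_eq` (generic injectivity on `π[R](ℍ × ℍ)`).

## Scope (NOT formalised here)

Runge's Lemma 4 proper — the Galois element `σ_Gal` and the EQUALITY `Γ(Δ) = ⟨σ_Gal, ψ_O(Sl(2,O))⟩` — and the
Elkies–Kumar factorisation through `(Γ ∪ Γσ)\ℍ²` are the subject of the sequel files of this row; the analytic
structure of `Γ(q)\H_q` and of `𝒜₂` is not used (topological orbit spaces only, as in row A4-70).

## References

* [Runge1999EndomorphismRingsAbelianSurfaces] B. Runge, Tohoku Math. J. 51 (1999) 283–303, §3 p. 287, §4 p. 291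
  (Lemma 4).
* [ElkiesKumar2014HilbertModularSurfaces] N. D. Elkies, A. Kumar, Algebra & Number Theory 8 (2014), §3–§4 ("the map
  `Γ\ℍ² → Sp₄(ℤ)\𝔖₂` … factors through the quotient `(Γ ∪ Γσ)\ℍ²` … and the induced map on this quotient is
  generically one to one [HvdG]"; [HvdG] = F. Hirzebruch, G. van der Geer, *Lectures on Hilbert modular surfaces*
  (1981), cited through this source).
* [BirkenhakeWilhelm2003] Ch. Birkenhake, H. Wilhelm, Trans. AMS 355 (2003), §1 (∗), §4 (7), Prop. 4.5, Prop. 4.9.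
* [HashimotoMurabayashi1995] K. Hashimoto, N. Murabayashi, Tohoku Math. J. 47 (1995), Def. 3.6, Prop. 3.7.
-/

noncomputable section

open Matrix Complex Module Function Set Topology
open scoped Pointwise UpperHalfPlane

namespace Literature.AlgebraicGeometry.ModuliOfAbelianVarieties

namespace SiegelModuli

open Literature.NumberTheory.Automorphic (siegelUpperHalfSpace)
open Literature.NumberTheory.ModularForms.SiegelUpperHalfSpace
open Literature.Geometry.Kaehler Literature.Geometry.Kaehler.ComplexTorus

/-! ## §1 The Humbert modular group `Γ(q) ≤ G_1 = Sp₄(ℤ)` of a singular relation `q` -/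

section Group

/-- **The Humbert modular group `Γ(q)` of the integer singular relation `q`: the stabiliser of the Humbert locus
`H_q ⊂ 𝔥₂` in `G_1 = gDHom(Sp₄(ℤ)) ⊂ Sp₄(ℝ)`** — Runge's `Γ(L) = {σ ∈ Γ_g ; σL = Lσ}`, "the largest subgroup of `Γ_g`
acting on `H(L)`", for `g = 2` and `L` the real quadratic algebra of `q` (whose `H(L)` is `H_q`); for `q` primitive of
invariant `Δ` this is "the Humbert modular group `Γ(F) = Γ(Δ)`" (up to conjugacy: `IsPrimitiveRel.exists_humbertModularGroup_eq_map_conj`).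
[cite: Runge1999EndomorphismRingsAbelianSurfaces, §3 p. 287 and §4 p. 291] -/
def humbertModularGroup (q : Fin 5 → ℤ) : Subgroup (Matrix.symplecticGroup (Fin 2) ℝ) :=
  levelGD (fun _ : Fin 2 ↦ (1 : ℕ)) 1 principalType_pos ⊓
    MulAction.stabilizer (Matrix.symplecticGroup (Fin 2) ℝ) (humbertLocus fun i ↦ (q i : ℂ))

variable {q : Fin 5 → ℤ}

/-- Membership: `γ ∈ Γ(q) ⟺ γ ∈ G_1` and `γ · Z ∈ H_q ⟺ Z ∈ H_q` for all `Z ∈ 𝔥₂`. [cite: Runge1999EndomorphismRingsAbelianSurfaces, §3 p. 287] -/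
theorem mem_humbertModularGroup_iff {A : Matrix.symplecticGroup (Fin 2) ℝ} :
    A ∈ humbertModularGroup q ↔ A ∈ levelGD (fun _ : Fin 2 ↦ (1 : ℕ)) 1 principalType_pos ∧
      ∀ Z : siegelUpperHalfSpace 2,
        A • Z ∈ humbertLocus (fun i ↦ (q i : ℂ)) ↔ Z ∈ humbertLocus (fun i ↦ (q i : ℂ)) := by
  rw [humbertModularGroup, Subgroup.mem_inf, MulAction.mem_stabilizer_set]

/-- `Γ(q) ≤ Γ₂ = G_1`. [cite: Runge1999EndomorphismRingsAbelianSurfaces, §3 p. 287] -/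
theorem humbertModularGroup_le_levelGD :
    humbertModularGroup q ≤ levelGD (fun _ : Fin 2 ↦ (1 : ℕ)) 1 principalType_pos :=
  inf_le_left

/-- "It is obvious that `Γ(L)` is acting on `H(L)`": `γ · Z ∈ H_q ⟺ Z ∈ H_q` for `γ ∈ Γ(q)`. [cite: Runge1999EndomorphismRingsAbelianSurfaces, §3 p. 287] -/
theorem smul_mem_humbertLocus_iff_of_mem {A : Matrix.symplecticGroup (Fin 2) ℝ} (hA : A ∈ humbertModularGroup q)
    (Z : siegelUpperHalfSpace 2) :
    A • Z ∈ humbertLocus (fun i ↦ (q i : ℂ)) ↔ Z ∈ humbertLocus (fun i ↦ (q i : ℂ)) :=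
  (mem_humbertModularGroup_iff.1 hA).2 Z

/-- `γ · H_q = H_q` for `γ ∈ Γ(q)`. [cite: Runge1999EndomorphismRingsAbelianSurfaces, §3 p. 287] -/
theorem smul_humbertLocus_eq_of_mem {A : Matrix.symplecticGroup (Fin 2) ℝ} (hA : A ∈ humbertModularGroup q) :
    A • humbertLocus (fun i ↦ (q i : ℂ)) = humbertLocus (fun i ↦ (q i : ℂ)) :=
  MulAction.mem_stabilizer_iff.1 (Subgroup.mem_inf.1 hA).2

/-- **"The group `Γ(L)` is the largest subgroup of `Γ_g` acting on `H(L)`"**: a subgroup of `G_1` lies in `Γ(q)` iff it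
maps `H_q` into itself. [cite: Runge1999EndomorphismRingsAbelianSurfaces, §3 p. 287] -/
theorem le_humbertModularGroup_iff {G : Subgroup (Matrix.symplecticGroup (Fin 2) ℝ)} :
    G ≤ humbertModularGroup q ↔ G ≤ levelGD (fun _ : Fin 2 ↦ (1 : ℕ)) 1 principalType_pos ∧
      ∀ A ∈ G, ∀ Z ∈ humbertLocus (fun i ↦ (q i : ℂ)), A • Z ∈ humbertLocus (fun i ↦ (q i : ℂ)) := by
  constructor
  · intro h
    exact ⟨h.trans humbertModularGroup_le_levelGD, fun A hA Z hZ ↦ (smul_mem_humbertLocus_iff_of_mem (h hA) Z).2 hZ⟩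
  · rintro ⟨hG, hact⟩ A hA
    refine mem_humbertModularGroup_iff.2 ⟨hG hA, fun Z ↦ ⟨fun h ↦ ?_, hact A hA Z⟩⟩
    have h' := hact A⁻¹ (inv_mem hA) _ h
    rwa [inv_smul_smul] at h'

/-- `H_{mq} = H_q` for `m ≠ 0` (integer coefficients). [cite: BirkenhakeWilhelm2003, §4 Prop. 4.7 (p. 1830)] -/
theorem humbertLocus_intCast_smul {m : ℤ} (hm : m ≠ 0) (q : Fin 5 → ℤ) :
    humbertLocus (fun i ↦ ((m • q) i : ℂ)) = humbertLocus (fun i ↦ (q i : ℂ)) := by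
  have hc : (fun i ↦ (((m • q) i : ℤ) : ℂ)) = (m : ℂ) • fun i ↦ (q i : ℂ) := by
    funext i; simp
  rw [hc]
  exact humbertLocus_smul (by exact_mod_cast hm) _

/-- `Γ(mq) = Γ(q)` for `m ≠ 0`: the group depends only on the line `ℚq` (on `L = ℚ(f_q)`). [cite: Runge1999EndomorphismRingsAbelianSurfaces, §3 p. 287] -/
theorem humbertModularGroup_smul {m : ℤ} (hm : m ≠ 0) (q : Fin 5 → ℤ) :
    humbertModularGroup (m • q) = humbertModularGroup q := by
  rw [humbertModularGroup, humbertModularGroup, humbertLocus_intCast_smul hm]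

/-- `Γ(−q) = Γ(q)`. [cite: Runge1999EndomorphismRingsAbelianSurfaces, §3 p. 287] -/
theorem humbertModularGroup_neg (q : Fin 5 → ℤ) : humbertModularGroup (-q) = humbertModularGroup q := by
  rw [humbertModularGroup, humbertModularGroup, humbertLocus_intCast_neg]

/-- `Γ(0) = Γ₂` (`H_0 = 𝔥₂`). [cite: Runge1999EndomorphismRingsAbelianSurfaces, §3 p. 287] [cite: BirkenhakeWilhelm2003, §4 Prop. 4.7 ("`H_0 = 𝒜₂`", p. 1830)] -/
theorem humbertModularGroup_zero :
    humbertModularGroup 0 = levelGD (fun _ : Fin 2 ↦ (1 : ℕ)) 1 principalType_pos := by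
  have h0 : (fun i ↦ ((0 : Fin 5 → ℤ) i : ℂ)) = 0 := by
    funext i; simp
  rw [humbertModularGroup, h0, humbertLocus_zero, MulAction.stabilizer_univ, inf_top_eq]

end Group

/-! ## §2 `Γ(q)` through the action `q ↦ q^M` of `Sp₄(ℤ)` on relations: `γ ∈ Γ(q) ⟺ q^γ = ±q` -/

section Transport

variable {q : Fin 5 → ℤ}

/-- **Transport, in `gDHom` form: `W ∈ H_{q^N} ⟺ gDHom(N) · W ∈ H_q`** for `N ∈ Sp₄(ℤ)` (row A4-59″ (7):
`H_{q^N} = ᵗN · H_q`, and `gDHom(N) = (ᵗN)⁻¹` in `Sp₄(ℝ)`). [cite: BirkenhakeWilhelm2003, §4 eq. (7) (p. 1827)] -/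
theorem mem_humbertLocus_humbertVectorConj_iff_gDHom_smul (M : symplecticLatticeGroup (fun _ : Fin 2 ↦ 1))
    (q : Fin 5 → ℤ) (W : siegelUpperHalfSpace 2) :
    W ∈ humbertLocus (fun i ↦ (humbertVectorConj
        ((M : GL (Fin 2 ⊕ Fin 2) ℤ) : Matrix (Fin 2 ⊕ Fin 2) (Fin 2 ⊕ Fin 2) ℤ) q i : ℂ)) ↔
      gDHom (fun _ : Fin 2 ↦ 1) principalType_pos M • W ∈ humbertLocus (fun i ↦ (q i : ℂ)) := by
  have hN := mem_symplecticLatticeGroup_iff.1 M.2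
  rw [mem_humbertLocus_humbertVectorConj_iff hN q W]
  have hP : (⟨toGD (fun _ : Fin 2 ↦ 1) _, toGD_mem principalType_pos hN⟩ : Matrix.symplecticGroup (Fin 2) ℝ) =
      (gDHom (fun _ : Fin 2 ↦ 1) principalType_pos M)⁻¹ := by
    rw [gDHom_inv]
  rw [hP, inv_inv]

/-- Set form: `H_{q^N} = gDHom(N)⁻¹ · H_q`. [cite: BirkenhakeWilhelm2003, §4 eq. (7) (p. 1827)] -/
theorem humbertLocus_humbertVectorConj_eq_inv_smul (M : symplecticLatticeGroup (fun _ : Fin 2 ↦ 1))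
    (q : Fin 5 → ℤ) :
    humbertLocus (fun i ↦ (humbertVectorConj
        ((M : GL (Fin 2 ⊕ Fin 2) ℤ) : Matrix (Fin 2 ⊕ Fin 2) (Fin 2 ⊕ Fin 2) ℤ) q i : ℂ)) =
      (gDHom (fun _ : Fin 2 ↦ 1) principalType_pos M)⁻¹ • humbertLocus (fun i ↦ (q i : ℂ)) := by
  ext W
  rw [Set.mem_inv_smul_set_iff, mem_humbertLocus_humbertVectorConj_iff_gDHom_smul]

/-- **`gDHom(N) ∈ Γ(q) ⟺ H_{q^N} = H_q`.** [cite: Runge1999EndomorphismRingsAbelianSurfaces, §3 p. 287] [cite: BirkenhakeWilhelm2003, §4 eq. (7) (p. 1827)] -/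
theorem gDHom_mem_humbertModularGroup_iff (M : symplecticLatticeGroup (fun _ : Fin 2 ↦ 1)) (q : Fin 5 → ℤ) :
    gDHom (fun _ : Fin 2 ↦ 1) principalType_pos M ∈ humbertModularGroup q ↔
      humbertLocus (fun i ↦ (humbertVectorConj
          ((M : GL (Fin 2 ⊕ Fin 2) ℤ) : Matrix (Fin 2 ⊕ Fin 2) (Fin 2 ⊕ Fin 2) ℤ) q i : ℂ)) =
        humbertLocus (fun i ↦ (q i : ℂ)) := by
  rw [mem_humbertModularGroup_iff]
  constructor
  · rintro ⟨-, h⟩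
    ext W
    rw [mem_humbertLocus_humbertVectorConj_iff_gDHom_smul, h]
  · intro h
    refine ⟨(siegelThreefold.mem_levelGD_one_iff principalType_pos).2 ⟨M, rfl⟩, fun W ↦ ?_⟩
    rw [← mem_humbertLocus_humbertVectorConj_iff_gDHom_smul, h]

/-- **For a primitive relation `q` with `Δ(q) > 0`: `gDHom(N) ∈ Γ(q) ⟺ q^N = q ∨ q^N = −q`** — Runge's `σL = Lσ`
(`σ` normalises the algebra `L = ℚ(f_q)`, i.e. fixes the line of the relation; row A4-65 F4: `H_{q₀} = H_{q₁} ⟺ q₁ = ±q₀`).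
[cite: Runge1999EndomorphismRingsAbelianSurfaces, §3 p. 287] [cite: BirkenhakeWilhelm2003, §4 Prop. 4.9 (p. 1831)] -/
theorem IsPrimitiveRel.gDHom_mem_humbertModularGroup_iff (hq : IsPrimitiveRel q) (hpos : 0 < humbertInvariant q)
    (M : symplecticLatticeGroup (fun _ : Fin 2 ↦ 1)) :
    gDHom (fun _ : Fin 2 ↦ 1) principalType_pos M ∈ humbertModularGroup q ↔
      humbertVectorConj ((M : GL (Fin 2 ⊕ Fin 2) ℤ) : Matrix (Fin 2 ⊕ Fin 2) (Fin 2 ⊕ Fin 2) ℤ) q = q ∨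
        humbertVectorConj ((M : GL (Fin 2 ⊕ Fin 2) ℤ) : Matrix (Fin 2 ⊕ Fin 2) (Fin 2 ⊕ Fin 2) ℤ) q = -q := by
  have hN := mem_symplecticLatticeGroup_iff.1 M.2
  rw [_root_.Literature.AlgebraicGeometry.ModuliOfAbelianVarieties.SiegelModuli.gDHom_mem_humbertModularGroup_iff]
  have h := hq.humbertLocus_eq_iff hpos (hq.of_humbertEquiv ⟨_, hN, rfl⟩)
  exact ⟨fun e ↦ h.1 e.symm, fun e ↦ (h.2 e).symm⟩

/-- **Equivalent relations have conjugate Humbert modular groups: `Γ(q^N) = gDHom(N)⁻¹ Γ(q) gDHom(N)`** (the stabiliser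
of the translate `H_{q^N} = gDHom(N)⁻¹ · H_q`). [cite: Runge1999EndomorphismRingsAbelianSurfaces, §3 p. 287 and Cor. 3 (p. 290)] [cite: BirkenhakeWilhelm2003, §4 eq. (7) (p. 1827)] -/
theorem humbertModularGroup_humbertVectorConj (M : symplecticLatticeGroup (fun _ : Fin 2 ↦ 1)) (q : Fin 5 → ℤ) :
    humbertModularGroup (humbertVectorConj
        ((M : GL (Fin 2 ⊕ Fin 2) ℤ) : Matrix (Fin 2 ⊕ Fin 2) (Fin 2 ⊕ Fin 2) ℤ) q) =
      (humbertModularGroup q).map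
        (MulAut.conj (gDHom (fun _ : Fin 2 ↦ 1) principalType_pos M)⁻¹).toMonoidHom := by
  set h : Matrix.symplecticGroup (Fin 2) ℝ := gDHom (fun _ : Fin 2 ↦ 1) principalType_pos M with hh
  have hlev : h ∈ levelGD (fun _ : Fin 2 ↦ (1 : ℕ)) 1 principalType_pos :=
    (siegelThreefold.mem_levelGD_one_iff principalType_pos).2 ⟨M, rfl⟩
  ext A
  rw [Subgroup.mem_map_equiv, MulAut.conj_symm_apply, inv_inv, mem_humbertModularGroup_iff,
    mem_humbertModularGroup_iff]
  have hlev_iff : h * A * h⁻¹ ∈ levelGD (fun _ : Fin 2 ↦ (1 : ℕ)) 1 principalType_pos ↔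
      A ∈ levelGD (fun _ : Fin 2 ↦ (1 : ℕ)) 1 principalType_pos := by
    constructor
    · intro hA
      have e : A = h⁻¹ * (h * A * h⁻¹) * h := by group
      rw [e]
      exact mul_mem (mul_mem (inv_mem hlev) hA) hlev
    · intro hA
      exact mul_mem (mul_mem hlev hA) (inv_mem hlev)
  rw [hlev_iff]
  refine and_congr_right fun _ ↦ ⟨fun H V ↦ ?_, fun H W ↦ ?_⟩
  · have e := H (h⁻¹ • V)
    rw [mem_humbertLocus_humbertVectorConj_iff_gDHom_smul, mem_humbertLocus_humbertVectorConj_iff_gDHom_smul,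
      ← hh, smul_inv_smul] at e
    rw [mul_smul, mul_smul]
    exact e
  · have e := H (h • W)
    rw [mul_smul, mul_smul, inv_smul_smul] at e
    rw [mem_humbertLocus_humbertVectorConj_iff_gDHom_smul, mem_humbertLocus_humbertVectorConj_iff_gDHom_smul, ← hh]
    exact e

/-- **"`Γ(F) = Γ(Δ)`": all primitive relations of one invariant `Δ` have conjugate Humbert modular groups** (they are
`Sp₄(ℤ)`-equivalent by Humbert's lemma, row A4-65). [cite: Runge1999EndomorphismRingsAbelianSurfaces, §4 p. 291 (with Thm. 2, p. 288)] [cite: BirkenhakeWilhelm2003, §4 Prop. 4.5 (p. 1828)] -/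
theorem IsPrimitiveRel.exists_humbertModularGroup_eq_map_conj {q q' : Fin 5 → ℤ} (hq : IsPrimitiveRel q)
    (hq' : IsPrimitiveRel q') (hΔ : humbertInvariant q' = humbertInvariant q) :
    ∃ g ∈ levelGD (fun _ : Fin 2 ↦ (1 : ℕ)) 1 principalType_pos,
      humbertModularGroup q' = (humbertModularGroup q).map (MulAut.conj g).toMonoidHom := by
  obtain ⟨N, hN, hconj⟩ := hq.humbertEquiv_of_humbertInvariant_eq hq' hΔ.symm
  refine ⟨(gDHom (fun _ : Fin 2 ↦ 1) principalType_pos (spUnit N hN))⁻¹,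
    inv_mem ((siegelThreefold.mem_levelGD_one_iff principalType_pos).2 ⟨spUnit N hN, rfl⟩), ?_⟩
  rw [← hconj]
  exact humbertModularGroup_humbertVectorConj (spUnit N hN) q

end Transport

/-! ## §3 Generic injectivity: "injective for points with `End⁰(A_τ) = L`" -/

section Generic

variable {q : Fin 5 → ℤ}

/-- **If `Z ∈ 𝔥₂` satisfies no integer singular relation outside `ℤq` and `γ ∈ Γ₂` moves `Z` INTO `H_q`, then
`γ ∈ Γ(q)`** (the relation `q^{γ}` holds at `Z`, so `q^γ = mq`; comparing invariants `m²Δ(q) = Δ(q) > 0` gives `m = ±1`,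
i.e. `H_{q^γ} = H_q`) — the heart of "the induced map `Γ(L)\H(L) → Γ_g\ℍ_g` is injective for points with
`End⁰(A_τ) = L`". [cite: Runge1999EndomorphismRingsAbelianSurfaces, §3 p. 287] -/
theorem mem_humbertModularGroup_of_smul_mem {Z : siegelUpperHalfSpace 2}
    (hgen : ∀ q' : Fin 5 → ℤ, singularRelation (fun i ↦ (q' i : ℂ)) (Z : Matrix (Fin 2) (Fin 2) ℂ) = 0 →
      ∃ m : ℤ, q' = m • q)
    {A : Matrix.symplecticGroup (Fin 2) ℝ} (hA : A ∈ levelGD (fun _ : Fin 2 ↦ (1 : ℕ)) 1 principalType_pos)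
    (hAZ : A • Z ∈ humbertLocus (fun i ↦ (q i : ℂ))) : A ∈ humbertModularGroup q := by
  by_cases hq : q = 0
  · subst hq
    rw [humbertModularGroup_zero]
    exact hA
  obtain ⟨M, rfl⟩ := (siegelThreefold.mem_levelGD_one_iff principalType_pos).1 hA
  set N : Matrix (Fin 2 ⊕ Fin 2) (Fin 2 ⊕ Fin 2) ℤ :=
    ((M : GL (Fin 2 ⊕ Fin 2) ℤ) : Matrix (Fin 2 ⊕ Fin 2) (Fin 2 ⊕ Fin 2) ℤ) with hNdef
  have hN : Nᵀ * typeForm (fun _ : Fin 2 ↦ 1) * N = typeForm fun _ : Fin 2 ↦ 1 :=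
    mem_symplecticLatticeGroup_iff.1 M.2
  -- the relation `q^N` holds at `Z`
  have hZ : Z ∈ humbertLocus (fun i ↦ (humbertVectorConj N q i : ℂ)) :=
    (mem_humbertLocus_humbertVectorConj_iff_gDHom_smul M q Z).2 hAZ
  obtain ⟨m, hm⟩ := hgen _ (mem_humbertLocus_iff.1 hZ)
  -- invariants: `m² Δ(q) = Δ(q^N) = Δ(q) > 0`
  have hne : humbertVectorConj N q ≠ 0 := humbertVectorConj_ne_zero hN hq
  have hpos : 0 < humbertInvariant (humbertVectorConj N q) := (humbertLocus_nonempty_iff_int hne).1 ⟨Z, hZ⟩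
  have hΔ : humbertInvariant (humbertVectorConj N q) = humbertInvariant q := humbertInvariant_humbertVectorConj hN q
  have hm1 : m = 1 ∨ m = -1 := by
    have h1 : m ^ 2 * humbertInvariant q = humbertInvariant q := by
      rw [← humbertInvariant_smul, ← hm, hΔ]
    have hq0 : humbertInvariant q ≠ 0 := by
      rw [← hΔ]; exact hpos.ne'
    have hsq : m * m = 1 := by
      have h2 : (m * m - 1) * humbertInvariant q = 0 := by linear_combination h1
      rcases mul_eq_zero.1 h2 with h | h
      · linear_combination h
      · exact absurd h hq0
    exact mul_self_eq_one_iff.1 hsq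
  have hloc : humbertLocus (fun i ↦ (humbertVectorConj N q i : ℂ)) = humbertLocus (fun i ↦ (q i : ℂ)) := by
    rw [hm]
    rcases hm1 with rfl | rfl
    · rw [one_smul]
    · exact humbertLocus_intCast_smul (by norm_num) q
  exact (gDHom_mem_humbertModularGroup_iff M q).2 hloc

/-- **Two points of `H_q` with the same image in `𝒜₂`, one of which has relation lattice `ℤq`, differ by an element
of `Γ(q)`.** [cite: Runge1999EndomorphismRingsAbelianSurfaces, §3 p. 287] -/
theorem exists_mem_humbertModularGroup_smul_eq {Z Z' : siegelUpperHalfSpace 2}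
    (hgen : ∀ q' : Fin 5 → ℤ, singularRelation (fun i ↦ (q' i : ℂ)) (Z : Matrix (Fin 2) (Fin 2) ℂ) = 0 →
      ∃ m : ℤ, q' = m • q)
    (hZ' : Z' ∈ humbertLocus (fun i ↦ (q i : ℂ))) (h : siegelThreefold.mk Z = siegelThreefold.mk Z') :
    ∃ A ∈ humbertModularGroup q, A • Z = Z' := by
  obtain ⟨M, hM⟩ := siegelThreefold.mk_eq_mk_iff.1 h
  refine ⟨gDHom (fun _ : Fin 2 ↦ 1) principalType_pos M,
    mem_humbertModularGroup_of_smul_mem hgen ((siegelThreefold.mem_levelGD_one_iff principalType_pos).2 ⟨M, rfl⟩) ?_, hM.symm⟩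
  rw [← hM]
  exact hZ'

end Generic

/-! ## §4 The standard model `Γ(q)\H_q` and its map to `𝒜₂ = Sp₄(ℤ)\𝔥₂` -/

section Quotient

variable (q : Fin 5 → ℤ)

/-- **"`Γ(L)` is acting on `H(L)`": the action of `Γ(q)` on `H_q`.** [cite: Runge1999EndomorphismRingsAbelianSurfaces, §3 p. 287] -/
instance humbertModularGroup.instMulAction :
    MulAction (humbertModularGroup q) (humbertLocus (fun i ↦ (q i : ℂ))) where
  smul A Z := ⟨(A : Matrix.symplecticGroup (Fin 2) ℝ) • (Z : siegelUpperHalfSpace 2),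
    (smul_mem_humbertLocus_iff_of_mem A.2 _).2 Z.2⟩
  one_smul Z := Subtype.ext (one_smul (Matrix.symplecticGroup (Fin 2) ℝ) (Z : siegelUpperHalfSpace 2))
  mul_smul A B Z := Subtype.ext
    (mul_smul (A : Matrix.symplecticGroup (Fin 2) ℝ) (B : Matrix.symplecticGroup (Fin 2) ℝ)
      (Z : siegelUpperHalfSpace 2))

/-- The action on `H_q` is the restriction of the action on `𝔥₂`. [cite: Runge1999EndomorphismRingsAbelianSurfaces, §3 p. 287] -/
@[simp] theorem humbertModularGroup.coe_smul (A : humbertModularGroup q) (Z : humbertLocus (fun i ↦ (q i : ℂ))) :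
    ((A • Z : humbertLocus (fun i ↦ (q i : ℂ))) : siegelUpperHalfSpace 2) =
      (A : Matrix.symplecticGroup (Fin 2) ℝ) • (Z : siegelUpperHalfSpace 2) :=
  rfl

/-- The orbit relation of `Γ(q)` on `H_q`. [cite: Runge1999EndomorphismRingsAbelianSurfaces, §3 p. 287] -/
abbrev humbertModularQuotient.setoid : Setoid (humbertLocus (fun i ↦ (q i : ℂ))) :=
  MulAction.orbitRel (humbertModularGroup q) (humbertLocus (fun i ↦ (q i : ℂ)))

/-- **Runge's standard model `Γ(q)\H_q`** ("By taking the quotient `Γ(F)\H(F)`, we get the standard model for Humbert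
surfaces"), as a topological orbit space. [cite: Runge1999EndomorphismRingsAbelianSurfaces, §3 p. 287 and §4 p. 291] -/
abbrev humbertModularQuotient : Type :=
  Quotient (humbertModularQuotient.setoid q)

/-- The canonical map `H_q → Γ(q)\H_q`. [cite: Runge1999EndomorphismRingsAbelianSurfaces, §3 p. 287] -/
def humbertModularQuotient.mk : humbertLocus (fun i ↦ (q i : ℂ)) → humbertModularQuotient q :=
  Quotient.mk (humbertModularQuotient.setoid q)

namespace humbertModularQuotient

/-- `H_q → Γ(q)\H_q` is onto. [cite: Runge1999EndomorphismRingsAbelianSurfaces, §3 p. 287] -/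
theorem mk_surjective : Function.Surjective (mk q) :=
  Quotient.mk_surjective

/-- `H_q → Γ(q)\H_q` is continuous. [cite: Runge1999EndomorphismRingsAbelianSurfaces, §3 p. 287] -/
theorem continuous_mk : Continuous (mk q) :=
  continuous_quotient_mk'

/-- `[γ · Z] = [Z]` for `γ ∈ Γ(q)`. [cite: Runge1999EndomorphismRingsAbelianSurfaces, §3 p. 287] -/
theorem mk_smul (A : humbertModularGroup q) (Z : humbertLocus (fun i ↦ (q i : ℂ))) : mk q (A • Z) = mk q Z :=
  Quotient.sound (MulAction.orbitRel_apply.2 (MulAction.mem_orbit Z A))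

/-- `[Z] = [Z′] ⟺ Z′ ∈ Γ(q) · Z`. [cite: Runge1999EndomorphismRingsAbelianSurfaces, §3 p. 287] -/
theorem mk_eq_mk_iff {Z Z' : humbertLocus (fun i ↦ (q i : ℂ))} :
    mk q Z = mk q Z' ↔ ∃ A : humbertModularGroup q, A • Z' = Z := by
  rw [mk, Quotient.eq]
  exact MulAction.orbitRel_apply.trans MulAction.mem_orbit_iff

/-- **The map `Γ(q)\H_q → 𝒜₂ = Γ₂\𝔥₂`, `[Z] ↦ [Z]`** (well defined since `Γ(q) ≤ Γ₂`). [cite: Runge1999EndomorphismRingsAbelianSurfaces, §3 p. 287 (the diagram `Γ(L)\H(L) → Γ_g\ℍ_g`)] -/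
def toSiegel : humbertModularQuotient q → siegelThreefold :=
  Quotient.lift (fun Z : humbertLocus (fun i ↦ (q i : ℂ)) ↦ siegelThreefold.mk (Z : siegelUpperHalfSpace 2)) (by
    rintro Z Z' ⟨A, rfl⟩
    obtain ⟨M, hM⟩ := (siegelThreefold.mem_levelGD_one_iff principalType_pos).1 (humbertModularGroup_le_levelGD A.2)
    show siegelThreefold.mk ((A : Matrix.symplecticGroup (Fin 2) ℝ) • (Z' : siegelUpperHalfSpace 2)) =
      siegelThreefold.mk (Z' : siegelUpperHalfSpace 2)
    rw [← hM]
    exact siegelThreefold.mk_smul M _)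

/-- `toSiegel [Z] = [Z]`. [cite: Runge1999EndomorphismRingsAbelianSurfaces, §3 p. 287] -/
@[simp] theorem toSiegel_mk (Z : humbertLocus (fun i ↦ (q i : ℂ))) :
    toSiegel q (mk q Z) = siegelThreefold.mk (Z : siegelUpperHalfSpace 2) :=
  rfl

/-- `Γ(q)\H_q → 𝒜₂` is continuous. [cite: Runge1999EndomorphismRingsAbelianSurfaces, §3 p. 287] -/
theorem continuous_toSiegel : Continuous (toSiegel q) :=
  Continuous.quotient_lift (siegelThreefold.continuous_mk.comp continuous_subtype_val) _

/-- **The image of `Γ(q)\H_q → 𝒜₂` is the image of `H_q` in `𝒜₂`.** [cite: Runge1999EndomorphismRingsAbelianSurfaces, §3 p. 287 (`C(L)` = the closure of the image of `Γ(L)\H(L)`)] -/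
theorem range_toSiegel :
    Set.range (toSiegel q) = siegelThreefold.mk '' humbertLocus (fun i ↦ (q i : ℂ)) := by
  ext x
  constructor
  · rintro ⟨t, rfl⟩
    induction t using Quotient.inductionOn with
    | h Z => exact ⟨Z, Z.2, rfl⟩
  · rintro ⟨Z, hZ, rfl⟩
    exact ⟨mk q ⟨Z, hZ⟩, rfl⟩

variable {q}

/-- **For a primitive relation the image is the Humbert surface `H_{Δ(q)} ⊂ 𝒜₂`** (row A4-70 F2:
`humbertSurface_eq_image_humbertLocus`). [cite: Runge1999EndomorphismRingsAbelianSurfaces, §4 p. 291 ("the standard model for Humbert surfaces")] [cite: HashimotoMurabayashi1995, Def. 3.6 and Prop. 3.7] -/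
theorem range_toSiegel_eq_humbertSurface (hq : IsPrimitiveRel q) :
    Set.range (toSiegel q) = humbertSurface (humbertInvariant q) := by
  rw [range_toSiegel, humbertSurface_eq_image_humbertLocus hq rfl]

/-- **GENERIC INJECTIVITY of `Γ(q)\H_q → 𝒜₂`: "injective for points with `End⁰(A_τ) = L`"** — if `[Z] = [Z′]` in `𝒜₂`
and the relation lattice of `Z` is `ℤq`, then `[Z] = [Z′]` in `Γ(q)\H_q`. [cite: Runge1999EndomorphismRingsAbelianSurfaces, §3 p. 287] -/
theorem mk_eq_mk_of_forall {Z Z' : humbertLocus (fun i ↦ (q i : ℂ))}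
    (hgen : ∀ q' : Fin 5 → ℤ, singularRelation (fun i ↦ (q' i : ℂ))
      ((Z : siegelUpperHalfSpace 2) : Matrix (Fin 2) (Fin 2) ℂ) = 0 → ∃ m : ℤ, q' = m • q)
    (h : siegelThreefold.mk (Z : siegelUpperHalfSpace 2) = siegelThreefold.mk (Z' : siegelUpperHalfSpace 2)) :
    mk q Z = mk q Z' := by
  obtain ⟨A, hA, hAZ⟩ := exists_mem_humbertModularGroup_smul_eq hgen Z'.2 h
  rw [mk_eq_mk_iff]
  refine ⟨⟨A, hA⟩⁻¹, Subtype.ext ?_⟩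
  rw [humbertModularGroup.coe_smul, Subgroup.coe_inv, inv_smul_eq_iff]
  exact hAZ.symm

/-- The same for the map `toSiegel`. [cite: Runge1999EndomorphismRingsAbelianSurfaces, §3 p. 287] -/
theorem eq_of_toSiegel_eq_of_forall {Z : humbertLocus (fun i ↦ (q i : ℂ))} {y : humbertModularQuotient q}
    (hgen : ∀ q' : Fin 5 → ℤ, singularRelation (fun i ↦ (q' i : ℂ))
      ((Z : siegelUpperHalfSpace 2) : Matrix (Fin 2) (Fin 2) ℂ) = 0 → ∃ m : ℤ, q' = m • q)
    (h : toSiegel q (mk q Z) = toSiegel q y) : mk q Z = y := by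
  induction y using Quotient.inductionOn with
  | h Z' => exact mk_eq_mk_of_forall hgen h

/-- **`Γ(q)\H_q → 𝒜₂` is injective on (the image of) the points whose relation lattice is `ℤq`.** [cite: Runge1999EndomorphismRingsAbelianSurfaces, §3 p. 287] -/
theorem injOn_toSiegel :
    Set.InjOn (toSiegel q) (mk q '' {Z | ∀ q' : Fin 5 → ℤ, singularRelation (fun i ↦ (q' i : ℂ))
      ((Z : siegelUpperHalfSpace 2) : Matrix (Fin 2) (Fin 2) ℂ) = 0 → ∃ m : ℤ, q' = m • q}) := by
  rintro _ ⟨Z, hZ, rfl⟩ y - h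
  exact eq_of_toSiegel_eq_of_forall hZ h

/-- **"Therefore it is generically injective": for `q` primitive with `Δ(q) > 0` the points of `H_q` with relation
lattice `ℤq` are DENSE in `H_q`** (row A4-65 F4, B–W Prop. 4.9 (2) "general member"). [cite: Runge1999EndomorphismRingsAbelianSurfaces, §3 p. 287] [cite: BirkenhakeWilhelm2003, §4 Prop. 4.9 (p. 1831)] -/
theorem _root_.Literature.AlgebraicGeometry.ModuliOfAbelianVarieties.SiegelModuli.IsPrimitiveRel.dense_setOf_forall_subtype
    (hq : IsPrimitiveRel q) (hpos : 0 < humbertInvariant q) :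
    Dense {Z : humbertLocus (fun i ↦ (q i : ℂ)) | ∀ q' : Fin 5 → ℤ, singularRelation (fun i ↦ (q' i : ℂ))
      ((Z : siegelUpperHalfSpace 2) : Matrix (Fin 2) (Fin 2) ℂ) = 0 → ∃ m : ℤ, q' = m • q} := by
  rw [Subtype.dense_iff]
  refine (hq.humbertLocus_subset_closure hpos).trans (closure_mono ?_)
  rintro Z ⟨hZ, hgen⟩
  exact ⟨⟨Z, hZ⟩, hgen, rfl⟩

/-- … and their images are dense in `Γ(q)\H_q`: the injectivity locus of `Γ(q)\H_q → 𝒜₂` is dense.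
[cite: Runge1999EndomorphismRingsAbelianSurfaces, §3 p. 287] [cite: BirkenhakeWilhelm2003, §4 Prop. 4.9 (p. 1831)] -/
theorem _root_.Literature.AlgebraicGeometry.ModuliOfAbelianVarieties.SiegelModuli.IsPrimitiveRel.dense_image_mk_setOf_forall
    (hq : IsPrimitiveRel q) (hpos : 0 < humbertInvariant q) :
    Dense (mk q '' {Z : humbertLocus (fun i ↦ (q i : ℂ)) | ∀ q' : Fin 5 → ℤ,
      singularRelation (fun i ↦ (q' i : ℂ)) ((Z : siegelUpperHalfSpace 2) : Matrix (Fin 2) (Fin 2) ℂ) = 0 →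
        ∃ m : ℤ, q' = m • q}) :=
  (mk_surjective q).denseRange.dense_image (continuous_mk q) (hq.dense_setOf_forall_subtype hpos)

end humbertModularQuotient

end Quotient

/-! ## §5 Runge's model `H_{(k,l,−1,0,0)} = π[R](ℍ × ℍ)`: integral lifts lie in `Γ((k,l,−1,0,0))` -/

section Runge

variable {k l : ℤ}

/-- **An INTEGRAL lift `(ᵗR 0; 0 R⁻¹) σ(g) (ᵗR 0; 0 R⁻¹)⁻¹ ∈ Γ₂` of `g ∈ SL₂(ℝ)²` lies in the Humbert modular group of
the normal form `(k, l, −1, 0, 0)`** (it maps `π[R](ℍ × ℍ) = H_{(k,l,−1,0,0)}` onto itself, row A4-70 F3) — the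
containment `ψ_O(Sl(2, O)) ⊆ Γ(Δ)` of Lemma 4, for every integral lift. [cite: Runge1999EndomorphismRingsAbelianSurfaces, §4 p. 291 (Lemma 4)] -/
theorem modularEmbeddingLift_mem_humbertModularGroup (hΔ : 0 < quadDisc k l)
    {g : Fin 2 → Matrix.SpecialLinearGroup (Fin 2) ℝ}
    (hg : modularEmbeddingLift k l hΔ g ∈ levelGD (fun _ : Fin 2 ↦ (1 : ℕ)) 1 principalType_pos) :
    modularEmbeddingLift k l hΔ g ∈ humbertModularGroup (humbertNormalForm k l) := by
  refine mem_humbertModularGroup_iff.2 ⟨hg, fun Z ↦ ⟨fun h ↦ ?_, modularEmbeddingLift_smul_mem_humbertLocus hΔ g⟩⟩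
  have h' := modularEmbeddingLift_smul_mem_humbertLocus hΔ g⁻¹ h
  rwa [modularEmbeddingLift_inv, inv_smul_smul] at h'

/-- **Generic injectivity on Runge's model: if `τ ∈ ℍ × ℍ` has relation lattice `ℤ · (k,l,−1,0,0)` (a dense set of `τ`,
row A4-65 F4 `dense_setOf_forall_singularRelation_modularEmbedding`) and `[π[R](τ)] = [π[R](τ′)]` in `𝒜₂`, then
`π[R](τ′) = γ · π[R](τ)` for some `γ ∈ Γ((k,l,−1,0,0))`.** [cite: Runge1999EndomorphismRingsAbelianSurfaces, §3 p. 287 and §4 p. 291] [cite: ElkiesKumar2014HilbertModularSurfaces, §4 ("generically one to one [HvdG]")] -/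
theorem exists_mem_humbertModularGroup_smul_modularEmbedding_eq (hΔ : 0 < quadDisc k l) {τ τ' : Fin 2 → ℍ}
    (hgen : ∀ q' : Fin 5 → ℤ, singularRelation (fun i ↦ (q' i : ℂ))
      (modularEmbedding k l hΔ τ : Matrix (Fin 2) (Fin 2) ℂ) = 0 → ∃ m : ℤ, q' = m • humbertNormalForm k l)
    (h : siegelThreefold.mk (modularEmbedding k l hΔ τ) = siegelThreefold.mk (modularEmbedding k l hΔ τ')) :
    ∃ A ∈ humbertModularGroup (humbertNormalForm k l),
      A • modularEmbedding k l hΔ τ = modularEmbedding k l hΔ τ' :=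
  exists_mem_humbertModularGroup_smul_eq hgen (modularEmbedding_mem_humbertLocus hΔ τ') h

end Runge

end SiegelModuli

end Literature.AlgebraicGeometry.ModuliOfAbelianVarieties
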